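import Mathlib.Algebra.MvPolynomial.CommRing
import Mathlib.Algebra.MvPolynomial.Degrees
import Mathlib.Algebra.MvPolynomial.Eval
import Mathlib.Analysis.Complex.Basic
import Mathlib.Data.Finsupp.Weight
import Literature.NumberTheory.Transcendental.ChudnovskyHeights
import HarnessLib

/-!
# Integer Taylor coefficients of integer polynomials (the tool of Diaz 1989, §II-3)

Topic `Literature/NumberTheory/Transcendental` (trunk T-TRANSCEND). Decomposition step for the
named fact `Literature.NumberTheory.Transcendental.Diaz1989_thm1` (`DiazMain.lean`), whose proof (G. Diaz, J. Number
Theory 31 (1989), §II-3, pp. 6–9, following an idea of G. V. Chudnovsky) modifies the auxiliary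
polynomials `P_{dλ} ∈ ℤ[Y]` into `P_{dλj} = (1/j!) D^j P_{dλ} ∈ ℤ[Y]` and uses three facts:
(i) the `P_{dλj}` still have integer coefficients, with degree `≤ deg P_{dλ}` and height at most
`2^{deg} ·` height; (ii) a non-zero polynomial has, at every point `θ̃`, some non-vanishing
`(1/j!) D^j P(θ̃)`; (iii) (the key identity, p. 9) if `∑_α P_α R_α = 0` and `j` has minimal length
among the indices with some `(1/j!)D^j P_α(θ̃) ≠ 0`, then `∑_α (1/j!)D^jP_α(θ̃) · R_α(θ̃) = 0`.

We formalise `(1/j!) D^j P` algebraically, with no division: `taylorCoeff j P` is the coefficient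
of `Z^j` in `P(Y + Z) ∈ ℤ[Y][Z]` (`shift P`), for polynomials over any commutative ring. Contents:

* `shift`, `taylorCoeff`; linearity, `taylorCoeff_mul` (Leibniz = Cauchy product),
  `taylorCoeff_zero_index` (`j = 0` gives `P` back);
* `eval₂_eq_sum_taylorCoeff` — Taylor's formula `P(x') = ∑_j (taylorCoeff j P)(x) (x' - x)^j`;
* `eq_zero_of_forall_eval₂_taylorCoeff` — (ii): if all `(taylorCoeff j P)(x) = 0` then `P = 0`;
* `sum_eval_taylorCoeff_mul_eq_zero` — (iii), the key identity of Diaz 1989, p. 9;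
* `totalDegree_taylorCoeff_le` — (i), degrees;
* `ℓ¹`-norms `L(P) = ∑ |coeff|` (`Literature.NumberTheory.Transcendental.Chudnovsky.l1`, `ChudnovskyHeights.lean`, whose
  ring-seminorm API nests to `ℤ[Y][Z]`): `l1_taylorCoeff_le : L(taylorCoeff j P) ≤ 2^{deg P} L(P)`
  — (i), heights; and the Lipschitz bound `norm_aeval_sub_aeval_le` (the "Lemme" of Diaz 1989,
  p. 7: `|P(x) - P(x')| ≤ ε L(P) deg(P) A^{deg P}` for `max |xᵢ - x'ᵢ| ≤ ε`,
  `max(1, |xᵢ|, |x'ᵢ|) ≤ A`; the plain evaluation bound is `norm_aeval_le_l1` there).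

Everything here is proved (no named facts).

## References

* G. Diaz, *Grands degrés de transcendance pour des familles d'exponentielles*, J. Number Theory
  31 (1989), 1–23, §II-3-1 (the polynomials `P_{dλj}`), Lemme p. 7, and p. 9 (the identity
  `∑ P_{dλj}(θ̃) R_{dλμ}(θ̃) = 0`).
* G. V. Chudnovsky, *Contributions to the theory of transcendental numbers*, AMS Math. Surveys
  Monogr. 19 (1984), Ch. 8, pp. 375–376 (the idea of derived auxiliary polynomials).
-/

noncomputable section


open MvPolynomial Finsupp Finset

namespace Literature.NumberTheory.Transcendental

namespace Taylor

variable {σ : Type*} {R : Type*} [CommRing R]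

/-! ### `P(Y + Z)` and its coefficients -/

/-- `shift P = P(Y + Z)`, as a polynomial in new variables `Z` (indexed by `σ` again) with
coefficients in `R[Y]`. [folklore] -/
def shift : MvPolynomial σ R →ₐ[R] MvPolynomial σ (MvPolynomial σ R) :=
  aeval fun i => C (X i) + X i

/-- `shift` on constants. [folklore] -/
@[simp] theorem shift_C (r : R) : shift (C r : MvPolynomial σ R) = C (C r) := by
  simp [shift]

/-- `shift` on variables: `Yᵢ ↦ Yᵢ + Zᵢ`. [folklore] -/
@[simp] theorem shift_X (i : σ) : shift (X i : MvPolynomial σ R) = C (X i) + X i := by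
  simp [shift]

/-- **The integer Taylor coefficient** `taylorCoeff j P = (1/j!) D^j P ∈ R[Y]`: the coefficient of
`Z^j` in `P(Y + Z)` (Diaz 1989, §II-3-1, "on vérifie que ces polynômes sont eux aussi à
coefficients dans ℤ"). [cite: Diaz1989, §II-3-1 p. 6] -/
def taylorCoeff (j : σ →₀ ℕ) (P : MvPolynomial σ R) : MvPolynomial σ R :=
  coeff j (shift P)

/-- Additivity in `P`. [folklore] -/
@[simp] theorem taylorCoeff_add (j : σ →₀ ℕ) (P Q : MvPolynomial σ R) :
    taylorCoeff j (P + Q) = taylorCoeff j P + taylorCoeff j Q := by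
  simp [taylorCoeff]

/-- `taylorCoeff j 0 = 0`. [folklore] -/
@[simp] theorem taylorCoeff_zero (j : σ →₀ ℕ) : taylorCoeff j (0 : MvPolynomial σ R) = 0 := by
  simp [taylorCoeff]

/-- Compatibility with finite sums. [folklore] -/
theorem taylorCoeff_sum {ι : Type*} (s : Finset ι) (f : ι → MvPolynomial σ R) (j : σ →₀ ℕ) :
    taylorCoeff j (∑ i ∈ s, f i) = ∑ i ∈ s, taylorCoeff j (f i) := by
  unfold taylorCoeff
  rw [map_sum]
  exact coeff_sum _ _ _

/-- Scalars come out. [folklore] -/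
theorem taylorCoeff_C_mul (j : σ →₀ ℕ) (r : R) (P : MvPolynomial σ R) :
    taylorCoeff j (C r * P) = C r * taylorCoeff j P := by
  simp [taylorCoeff, coeff_C_mul]

/-- **Leibniz rule** (Cauchy product): `(1/j!)D^j(PQ) = ∑_{a+b=j} (1/a!)D^aP · (1/b!)D^bQ`.
[folklore] -/
theorem taylorCoeff_mul [DecidableEq σ] (j : σ →₀ ℕ) (P Q : MvPolynomial σ R) :
    taylorCoeff j (P * Q) = ∑ x ∈ antidiagonal j, taylorCoeff x.1 P * taylorCoeff x.2 Q := by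
  simp only [taylorCoeff, map_mul, coeff_mul]

/-- The Taylor coefficient of index `0` is `P` itself (`P(Y + 0) = P(Y)`). [folklore] -/
@[simp] theorem taylorCoeff_zero_index (P : MvPolynomial σ R) : taylorCoeff 0 P = P := by
  have key : (constantCoeff.comp (shift : MvPolynomial σ R →ₐ[R] _).toRingHom) =
      RingHom.id (MvPolynomial σ R) := by
    apply ringHom_ext
    · intro r
      simp
    · intro i
      simp
  have := RingHom.congr_fun key P
  simpa [taylorCoeff, ← constantCoeff_eq] using this

/-! ### Taylor's formula and its consequences -/

/-- **Taylor's formula**: for points `x, x'` in an `R`-algebra (via `f : R →+* S`),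
`P(x') = ∑_j (taylorCoeff j P)(x) · ∏ᵢ (x'ᵢ - xᵢ)^{jᵢ}`, the sum running over the support of
`P(Y + Z)`. [folklore] -/
theorem eval₂_eq_sum_taylorCoeff {S : Type*} [CommRing S] (f : R →+* S) (x x' : σ → S)
    (P : MvPolynomial σ R) :
    eval₂ f x' P = ∑ j ∈ (shift P).support,
      eval₂ f x (taylorCoeff j P) * ∏ i ∈ j.support, (x' i - x i) ^ j i := by
  set φ : MvPolynomial σ (MvPolynomial σ R) →+* S :=
    eval₂Hom (eval₂Hom f x) (fun i => x' i - x i) with hφ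
  have key : φ.comp (shift : MvPolynomial σ R →ₐ[R] _).toRingHom = eval₂Hom f x' := by
    apply ringHom_ext
    · intro r
      simp [hφ]
    · intro i
      simp [hφ]
  have h1 : eval₂ f x' P = φ (shift P) := by
    rw [← coe_eval₂Hom, ← key]
    rfl
  rw [h1, hφ, coe_eval₂Hom, eval₂_eq]
  rfl

/-- **A non-zero polynomial has a non-vanishing Taylor coefficient at every point**: if
`f : R →+* S` is injective and all `(taylorCoeff j P)(x)` vanish, then `P = 0` (Diaz 1989, §II-3-1:
"`P_{dλ}` est non nul et donc il existe un indice de dérivation `j` tel que `D^jP_{dλ}` ne s'annule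
pas en `θ̃`"). [folklore] -/
theorem eq_zero_of_forall_eval₂_taylorCoeff {S : Type*} [CommRing S] {f : R →+* S}
    (hf : Function.Injective f) (x : σ → S) {P : MvPolynomial σ R}
    (h : ∀ j, eval₂ f x (taylorCoeff j P) = 0) : P = 0 := by
  -- `ψ₊ P = P^f(Y + x)`, `ψ₋ Q = Q(Y - x)`; `ψ₋ ∘ ψ₊ = map f`.
  set ψp : MvPolynomial σ R →+* MvPolynomial σ S :=
    eval₂Hom (C.comp f) (fun i => X i + C (x i)) with hψp
  set ψm : MvPolynomial σ S →+* MvPolynomial σ S :=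
    eval₂Hom C (fun i => X i - C (x i)) with hψm
  have hcomp : ψm.comp ψp = map f := by
    apply ringHom_ext
    · intro r
      simp [hψp, hψm]
    · intro i
      simp [hψp, hψm]
  -- `ψ₊ P = 0` by Taylor's formula at the points `C ∘ x`, `Y + C x`.
  have hC : ∀ Q : MvPolynomial σ R,
      eval₂ ((C : S →+* MvPolynomial σ S).comp f) (fun i => (C (x i) : MvPolynomial σ S)) Q =
        C (eval₂ f x Q) := by
    intro Q
    have e : (eval₂Hom ((C : S →+* MvPolynomial σ S).comp f) (fun i => (C (x i) : MvPolynomial σ S)) :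
        MvPolynomial σ R →+* MvPolynomial σ S) =
        (C : S →+* MvPolynomial σ S).comp (eval₂Hom f x) := by
      apply ringHom_ext
      · intro r
        simp
      · intro i
        simp
    exact RingHom.congr_fun e Q
  have hzero : ψp P = 0 := by
    rw [hψp, coe_eval₂Hom, eval₂_eq_sum_taylorCoeff ((C : S →+* MvPolynomial σ S).comp f)
      (fun i => (C (x i) : MvPolynomial σ S)) _ P]
    refine Finset.sum_eq_zero fun j _ => ?_
    rw [hC, h j, C_0, zero_mul]
  have : map f P = 0 := by
    rw [← hcomp, RingHom.comp_apply, hzero, map_zero]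
  exact map_injective f hf (by rw [this, map_zero])

/-- **The key identity of Diaz 1989, p. 9.** Let `P_α, R_α` (`α ∈ s`) be polynomials with
`∑_α P_α R_α = 0`, `x` a point, and `j` an index such that `(taylorCoeff j' P_α)(x) = 0` for all
`α` and all `j'` of length `< |j|` (minimality of the length of `j`). Then
`∑_α (taylorCoeff j P_α)(x) · R_α(x) = 0`. (Proof: take the `j`-th Taylor coefficient of
`0 = ∑ P_α R_α` by the Leibniz rule and evaluate at `x`; the terms with `j' ≠ j` die by minimality,
the term `j' = j` has cofactor `taylorCoeff 0 R_α = R_α`.)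
[cite: Diaz1989, §II-3-2 (b) p. 9] -/
theorem sum_eval_taylorCoeff_mul_eq_zero [DecidableEq σ] {S : Type*} [CommRing S] (f : R →+* S)
    (x : σ → S) {ι : Type*} (s : Finset ι) (P Rr : ι → MvPolynomial σ R)
    (hsum : ∑ a ∈ s, P a * Rr a = 0) (j : σ →₀ ℕ)
    (hmin : ∀ a ∈ s, ∀ j' : σ →₀ ℕ, degree j' < degree j → eval₂ f x (taylorCoeff j' (P a)) = 0) :
    ∑ a ∈ s, eval₂ f x (taylorCoeff j (P a)) * eval₂ f x (Rr a) = 0 := by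
  have h0 : taylorCoeff j (∑ a ∈ s, P a * Rr a) = 0 := by rw [hsum, taylorCoeff_zero]
  rw [taylorCoeff_sum] at h0
  have h1 := congrArg (eval₂ f x) h0
  rw [eval₂_zero, eval₂_sum] at h1
  rw [← h1]
  refine Finset.sum_congr rfl fun a ha => ?_
  rw [taylorCoeff_mul, eval₂_sum]
  -- Only the term `(j, 0)` of the antidiagonal survives.
  rw [Finset.sum_eq_single (j, 0)]
  · simp [eval₂_mul]
  · rintro ⟨a1, a2⟩ hmem hne
    have hadd : a1 + a2 = j := mem_antidiagonal.mp hmem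
    have ha1 : a1 ≠ j := by
      rintro rfl
      apply hne
      have : a2 = 0 := by simpa using hadd
      rw [this]
    have hlt : degree a1 < degree j := by
      have hle : degree a1 ≤ degree j := by
        rw [← hadd, map_add]
        exact Nat.le_add_right _ _
      refine lt_of_le_of_ne hle fun heq => ha1 ?_
      have h2 : degree a2 = 0 := by
        have := congrArg degree hadd
        rw [map_add, heq] at this
        omega
      rw [degree_eq_zero_iff] at h2
      simpa [h2] using hadd
    rw [eval₂_mul, hmin a ha a1 hlt, zero_mul]
  · intro hn
    exact absurd (mem_antidiagonal.mpr (add_zero j)) hn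

/-! ### Degrees -/

/-- Bidegree bound for a polynomial in `Z` over `R[Y]`: every coefficient of `Z^j` has
`Y`-degree `≤ N - |j|`. [folklore] -/
def BidegLE (F : MvPolynomial σ (MvPolynomial σ R)) (N : ℕ) : Prop :=
  ∀ j ∈ F.support, (coeff j F).totalDegree + degree j ≤ N

/-- Monotonicity of the bidegree bound in `N`. [folklore] -/
theorem BidegLE.mono {F : MvPolynomial σ (MvPolynomial σ R)} {N N' : ℕ} (h : BidegLE F N)
    (hN : N ≤ N') : BidegLE F N' := fun j hj => (h j hj).trans hN

/-- A bound valid for all `j` gives `BidegLE`. [folklore] -/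
theorem BidegLE.of_coeff {F : MvPolynomial σ (MvPolynomial σ R)} {N : ℕ}
    (h : ∀ j, (coeff j F).totalDegree + degree j ≤ N) : BidegLE F N := fun j _ => h j

/-- `0` has every bidegree bound. [folklore] -/
theorem bidegLE_zero (N : ℕ) : BidegLE (0 : MvPolynomial σ (MvPolynomial σ R)) N := by
  intro j hj
  simp at hj

/-- Sums preserve a bidegree bound. [folklore] -/
theorem BidegLE.add [DecidableEq σ] {F G : MvPolynomial σ (MvPolynomial σ R)} {N : ℕ}
    (hF : BidegLE F N) (hG : BidegLE G N) : BidegLE (F + G) N := by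
  intro j hj
  rw [coeff_add]
  have hj' := MvPolynomial.support_add hj
  rw [Finset.mem_union] at hj'
  by_cases h1 : j ∈ F.support <;> by_cases h2 : j ∈ G.support
  · calc (coeff j F + coeff j G).totalDegree + degree j
        ≤ max (coeff j F).totalDegree (coeff j G).totalDegree + degree j :=
          Nat.add_le_add_right (totalDegree_add _ _) _
      _ ≤ N := by
          rcases max_cases (coeff j F).totalDegree (coeff j G).totalDegree with ⟨h, _⟩ | ⟨h, _⟩ <;>
            rw [h]
          · exact hF j h1
          · exact hG j h2
  · rw [MvPolynomial.notMem_support_iff.mp h2, add_zero]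
    exact hF j h1
  · rw [MvPolynomial.notMem_support_iff.mp h1, zero_add]
    exact hG j h2
  · exact absurd hj' (by tauto)

/-- Finite sums preserve a bidegree bound. [folklore] -/
theorem BidegLE.sum [DecidableEq σ] {ι : Type*} (s : Finset ι)
    {F : ι → MvPolynomial σ (MvPolynomial σ R)} {N : ℕ} (h : ∀ i ∈ s, BidegLE (F i) N) :
    BidegLE (∑ i ∈ s, F i) N := by
  classical
  induction s using Finset.induction_on with
  | empty => simpa using bidegLE_zero N
  | insert a s ha ih =>
    rw [Finset.sum_insert ha]
    exact (h a (Finset.mem_insert_self _ _)).add (ih fun i hi => h i (Finset.mem_insert_of_mem hi))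

/-- Bidegree bounds add under products. [folklore] -/
theorem BidegLE.mul [DecidableEq σ] {F G : MvPolynomial σ (MvPolynomial σ R)} {N N' : ℕ}
    (hF : BidegLE F N) (hG : BidegLE G N') : BidegLE (F * G) (N + N') := by
  intro j hj
  rw [coeff_mul]
  -- Some term of the Cauchy product is non-zero, whence `|j| ≤ N + N'`.
  have hdegj : degree j ≤ N + N' := by
    have hne : coeff j (F * G) ≠ 0 := MvPolynomial.mem_support_iff.mp hj
    rw [coeff_mul] at hne
    obtain ⟨⟨a, b⟩, hab, hterm⟩ := Finset.exists_ne_zero_of_sum_ne_zero hne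
    have hab' : a + b = j := mem_antidiagonal.mp hab
    have ha : a ∈ F.support := MvPolynomial.mem_support_iff.mpr (left_ne_zero_of_mul hterm)
    have hb : b ∈ G.support := MvPolynomial.mem_support_iff.mpr (right_ne_zero_of_mul hterm)
    have h1 := hF a ha
    have h2 := hG b hb
    have h4 : degree j = degree a + degree b := by rw [← hab', map_add]
    omega
  -- each term of the Cauchy product has small degree
  have hterm : ∀ x ∈ antidiagonal j,
      (coeff x.1 F * coeff x.2 G).totalDegree + degree j ≤ N + N' := by
    rintro ⟨a, b⟩ hab
    have hab' : a + b = j := mem_antidiagonal.mp hab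
    by_cases ha : a ∈ F.support
    · by_cases hb : b ∈ G.support
      · have h1 := hF a ha
        have h2 := hG b hb
        have h3 := totalDegree_mul (coeff a F) (coeff b G)
        have h4 : degree j = degree a + degree b := by rw [← hab', map_add]
        simp only at h3 ⊢
        omega
      · rw [MvPolynomial.notMem_support_iff.mp hb, mul_zero, totalDegree_zero, zero_add]
        exact hdegj
    · rw [MvPolynomial.notMem_support_iff.mp ha, zero_mul, totalDegree_zero, zero_add]
      exact hdegj
  calc (∑ x ∈ antidiagonal j, coeff x.1 F * coeff x.2 G).totalDegree + degree j
      ≤ ((antidiagonal j).sup fun x => (coeff x.1 F * coeff x.2 G).totalDegree) + degree j :=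
        Nat.add_le_add_right (totalDegree_finsetSum _ _) _
    _ ≤ N + N' := by
        have hne : (antidiagonal j).Nonempty := ⟨(j, 0), mem_antidiagonal.mpr (add_zero j)⟩
        obtain ⟨x, hx, hmax⟩ := Finset.exists_mem_eq_sup _ hne
          (fun x => (coeff x.1 F * coeff x.2 G).totalDegree)
        rw [hmax]
        exact hterm x hx

/-- Constants (in `Z`) have bidegree their `Y`-degree. [folklore] -/
theorem bidegLE_C (q : MvPolynomial σ R) : BidegLE (C q : MvPolynomial σ (MvPolynomial σ R)) q.totalDegree := by
  classical
  intro j hj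
  rw [support_C] at hj
  split_ifs at hj with h
  · simp at hj
  · rw [Finset.mem_singleton] at hj
    subst hj
    simp

/-- Scalars have bidegree `0`. [folklore] -/
theorem bidegLE_C_C (r : R) : BidegLE (C (C r) : MvPolynomial σ (MvPolynomial σ R)) 0 :=
  (bidegLE_C (C r)).mono (totalDegree_C r).le

/-- Monic monomials in `Z` have bidegree their length. [folklore] -/
theorem bidegLE_monomial_one (e : σ →₀ ℕ) :
    BidegLE (monomial e (1 : MvPolynomial σ R)) (degree e) := by
  classical
  intro j hj
  rw [support_monomial] at hj
  split_ifs at hj with h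
  · simp at hj
  · rw [Finset.mem_singleton] at hj
    subst hj
    simp

/-- Bidegree bounds under powers. [folklore] -/
theorem BidegLE.pow [DecidableEq σ] {F : MvPolynomial σ (MvPolynomial σ R)} {N : ℕ}
    (hF : BidegLE F N) (k : ℕ) : BidegLE (F ^ k) (k * N) := by
  induction k with
  | zero =>
    intro j hj
    rw [pow_zero] at hj ⊢
    classical
    rw [← C_1, support_C] at hj
    split_ifs at hj with h
    · simp at hj
    · rw [Finset.mem_singleton] at hj
      subst hj
      simp
  | succ k ih =>
    rw [pow_succ, Nat.succ_mul]
    exact ih.mul hF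

/-- Bidegree bounds under finite products. [folklore] -/
theorem BidegLE.prod [DecidableEq σ] {ι : Type*} (s : Finset ι)
    {F : ι → MvPolynomial σ (MvPolynomial σ R)} {N : ι → ℕ} (h : ∀ i ∈ s, BidegLE (F i) (N i)) :
    BidegLE (∏ i ∈ s, F i) (∑ i ∈ s, N i) := by
  classical
  induction s using Finset.induction_on with
  | empty =>
    simp only [Finset.prod_empty, Finset.sum_empty]
    rw [← C_1, ← C_1]
    exact bidegLE_C_C 1
  | insert a s ha ih =>
    rw [Finset.prod_insert ha, Finset.sum_insert ha]
    exact (h a (Finset.mem_insert_self _ _)).mul (ih fun i hi => h i (Finset.mem_insert_of_mem hi))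

/-- `Yᵢ + Zᵢ` has bidegree `1`. [folklore] -/
theorem bidegLE_shift_X [DecidableEq σ] (i : σ) :
    BidegLE (C (X i) + X i : MvPolynomial σ (MvPolynomial σ R)) 1 := by
  refine BidegLE.add ((bidegLE_C (X i)).mono ?_) ?_
  · calc (X i : MvPolynomial σ R).totalDegree ≤ (Finsupp.single i 1).sum fun _ => id :=
          totalDegree_monomial_le _ _
      _ = 1 := by simp
  · have h := bidegLE_monomial_one (σ := σ) (R := R) (Finsupp.single i 1)
    rw [degree_single] at h
    exact h

/-- `P(Y+Z)` has bidegree bounded by the total degree of `P`. [folklore] -/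
theorem bidegLE_shift [DecidableEq σ] (P : MvPolynomial σ R) : BidegLE (shift P) P.totalDegree := by
  conv_lhs => rw [as_sum P]
  rw [map_sum]
  refine BidegLE.sum _ fun e he => ?_
  have hdeg : degree e ≤ P.totalDegree := le_totalDegree he
  refine BidegLE.mono ?_ hdeg
  rw [show monomial e (coeff e P) = C (coeff e P) * monomial e 1 by
    rw [C_mul_monomial, mul_one], map_mul, shift_C]
  have hmono : (shift (monomial e (1 : R)) : MvPolynomial σ (MvPolynomial σ R)) =
      ∏ i ∈ e.support, (C (X i) + X i) ^ e i := by
    rw [shift, aeval_monomial, map_one, one_mul, Finsupp.prod]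
  rw [hmono]
  have hp : BidegLE (∏ i ∈ e.support, (C (X i) + X i : MvPolynomial σ (MvPolynomial σ R)) ^ e i)
      (∑ i ∈ e.support, e i * 1) :=
    BidegLE.prod _ fun i _ => (bidegLE_shift_X i).pow (e i)
  simp only [mul_one] at hp
  have := (bidegLE_C_C (σ := σ) (coeff e P)).mul hp
  simpa [degree_apply] using this

/-- **Degrees do not increase**: `deg (taylorCoeff j P) + |j| ≤ deg P` whenever
`taylorCoeff j P ≠ 0`; in particular `deg (taylorCoeff j P) ≤ deg P` (Diaz 1989, (2):
`deg P_{dλj} ≤ deg P_{dλ}`). [cite: Diaz1989, §II-3-2 (2) p. 8] -/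
theorem totalDegree_taylorCoeff_add_degree_le [DecidableEq σ] (j : σ →₀ ℕ) (P : MvPolynomial σ R)
    (h : taylorCoeff j P ≠ 0) : (taylorCoeff j P).totalDegree + degree j ≤ P.totalDegree :=
  bidegLE_shift P j (MvPolynomial.mem_support_iff.mpr h)

/-- `deg (taylorCoeff j P) ≤ deg P`. [cite: Diaz1989, §II-3-2 (2) p. 8] -/
theorem totalDegree_taylorCoeff_le [DecidableEq σ] (j : σ →₀ ℕ) (P : MvPolynomial σ R) :
    (taylorCoeff j P).totalDegree ≤ P.totalDegree := by
  by_cases h : taylorCoeff j P = 0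
  · rw [h, totalDegree_zero]
    exact Nat.zero_le _
  · exact le_trans (Nat.le_add_right _ _) (totalDegree_taylorCoeff_add_degree_le j P h)

/-- Taylor coefficients of index of length `> deg P` vanish. [folklore] -/
theorem taylorCoeff_eq_zero_of_lt [DecidableEq σ] (j : σ →₀ ℕ) (P : MvPolynomial σ R)
    (h : P.totalDegree < degree j) : taylorCoeff j P = 0 := by
  by_contra hne
  have := totalDegree_taylorCoeff_add_degree_le j P hne
  omega

end Taylor

/-! ### Evaluation bounds (the `ℓ¹`-norm `L = Literature.Periods.Chudnovsky.l1`) -/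

section Length

open Chudnovsky

variable {σ : Type*}

/-- `|a^k - b^k| ≤ k A^k ε` for `|a|, |b| ≤ A`, `1 ≤ A`, `|a - b| ≤ ε`. [folklore] -/
theorem norm_pow_sub_pow_le' {a b : ℂ} {A ε : ℝ} (hA : 1 ≤ A) (ha : ‖a‖ ≤ A) (hb : ‖b‖ ≤ A)
    (hab : ‖a - b‖ ≤ ε) (k : ℕ) : ‖a ^ k - b ^ k‖ ≤ k * A ^ k * ε := by
  have hA0 : 0 ≤ A := zero_le_one.trans hA
  rw [← (Commute.all a b).geom_sum₂_mul, norm_mul]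
  have hgeom : ‖∑ i ∈ Finset.range k, a ^ i * b ^ (k - 1 - i)‖ ≤ k * A ^ k := by
    calc ‖∑ i ∈ Finset.range k, a ^ i * b ^ (k - 1 - i)‖
        ≤ ∑ i ∈ Finset.range k, ‖a ^ i * b ^ (k - 1 - i)‖ := norm_sum_le _ _
      _ ≤ ∑ _i ∈ Finset.range k, A ^ k := by
          refine Finset.sum_le_sum fun i hi => ?_
          rw [Finset.mem_range] at hi
          rw [norm_mul, norm_pow, norm_pow]
          calc ‖a‖ ^ i * ‖b‖ ^ (k - 1 - i) ≤ A ^ i * A ^ (k - 1 - i) :=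
                mul_le_mul (pow_le_pow_left₀ (norm_nonneg _) ha _)
                  (pow_le_pow_left₀ (norm_nonneg _) hb _) (by positivity) (by positivity)
            _ = A ^ (k - 1) := by rw [← pow_add]; congr 1; omega
            _ ≤ A ^ k := pow_le_pow_right₀ hA (Nat.sub_le _ _)
      _ = k * A ^ k := by rw [Finset.sum_const, Finset.card_range, nsmul_eq_mul]
  calc ‖∑ i ∈ Finset.range k, a ^ i * b ^ (k - 1 - i)‖ * ‖a - b‖
      ≤ (k * A ^ k) * ε := mul_le_mul hgeom hab (norm_nonneg _) (by positivity)
    _ = k * A ^ k * ε := by ring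

/-- Monomials are Lipschitz: `|x^e - x'^e| ≤ |e| A^{|e|} ε`. [folklore] -/
theorem norm_monomial_sub_le (e : σ →₀ ℕ) (x x' : σ → ℂ) {A ε : ℝ} (hA : 1 ≤ A) (hε0 : 0 ≤ ε)
    (hx : ∀ i, ‖x i‖ ≤ A) (hx' : ∀ i, ‖x' i‖ ≤ A) (hε : ∀ i, ‖x i - x' i‖ ≤ ε) :
    ‖(∏ i ∈ e.support, x i ^ e i) - ∏ i ∈ e.support, x' i ^ e i‖ ≤ degree e * A ^ degree e * ε := by
  classical
  have hA0 : 0 ≤ A := zero_le_one.trans hA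
  -- general statement over a finset of variables
  suffices H : ∀ s : Finset σ, ‖(∏ i ∈ s, x i ^ e i) - ∏ i ∈ s, x' i ^ e i‖ ≤
      (∑ i ∈ s, e i) * A ^ (∑ i ∈ s, e i) * ε by
    have := H e.support
    rwa [← degree_apply] at this
  intro s
  induction s using Finset.induction_on with
  | empty => simp
  | insert a s ha ih =>
    rw [Finset.prod_insert ha, Finset.prod_insert ha, Finset.sum_insert ha]
    set U := ∏ i ∈ s, x i ^ e i
    set U' := ∏ i ∈ s, x' i ^ e i
    set N := ∑ i ∈ s, e i
    have hU' : ‖U'‖ ≤ A ^ N := by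
      calc ‖U'‖ ≤ ∏ i ∈ s, A ^ e i := by
            rw [norm_prod]
            exact Finset.prod_le_prod (fun i _ => norm_nonneg _) fun i _ => by
              rw [norm_pow]; exact pow_le_pow_left₀ (norm_nonneg _) (hx' i) _
        _ = A ^ N := Finset.prod_pow_eq_pow_sum _ _ _
    have hxa : ‖x a ^ e a‖ ≤ A ^ e a := by
      rw [norm_pow]; exact pow_le_pow_left₀ (norm_nonneg _) (hx a) _
    have e1 : x a ^ e a * U - x' a ^ e a * U' =
        x a ^ e a * (U - U') + (x a ^ e a - x' a ^ e a) * U' := by ring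
    rw [e1]
    have hNε : 0 ≤ (N : ℝ) * A ^ N * ε := by positivity
    calc ‖x a ^ e a * (U - U') + (x a ^ e a - x' a ^ e a) * U'‖
        ≤ ‖x a ^ e a‖ * ‖U - U'‖ + ‖x a ^ e a - x' a ^ e a‖ * ‖U'‖ := by
          refine (norm_add_le _ _).trans ?_
          rw [norm_mul, norm_mul]
      _ ≤ A ^ e a * (N * A ^ N * ε) + (e a * A ^ e a * ε) * A ^ N :=
          add_le_add (mul_le_mul hxa ih (norm_nonneg _) (by positivity))
            (mul_le_mul (norm_pow_sub_pow_le' hA (hx a) (hx' a) (hε a) _) hU' (norm_nonneg _)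
              (by positivity))
      _ = (e a + N) * A ^ (e a + N) * ε := by rw [pow_add]; ring
      _ = ((e a + N : ℕ) : ℝ) * A ^ (e a + N) * ε := by push_cast; ring

/-- **The "Lemme" of Diaz 1989, p. 7** (in a convenient form): for `max(1, |xᵢ|, |x'ᵢ|) ≤ A` and
`max |xᵢ - x'ᵢ| ≤ ε` (`ε ≥ 0`), `|P(x) - P(x')| ≤ L(P) · deg P · A^{deg P} · ε`, `L` the
`ℓ¹`-norm of the coefficients. [cite: Diaz1989, §II-3-2 Lemme p. 7] -/
theorem norm_aeval_sub_aeval_le (P : MvPolynomial σ ℤ) (x x' : σ → ℂ) {A ε : ℝ} (hA : 1 ≤ A)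
    (hε0 : 0 ≤ ε) (hx : ∀ i, ‖x i‖ ≤ A) (hx' : ∀ i, ‖x' i‖ ≤ A) (hε : ∀ i, ‖x i - x' i‖ ≤ ε) :
    ‖aeval x P - aeval x' P‖ ≤ l1 P * P.totalDegree * A ^ P.totalDegree * ε := by
  classical
  have hA0 : 0 ≤ A := zero_le_one.trans hA
  rw [MvPolynomial.aeval_def, MvPolynomial.aeval_def, eval₂_eq, eval₂_eq, ← Finset.sum_sub_distrib]
  calc ‖∑ d ∈ P.support, ((algebraMap ℤ ℂ) (coeff d P) * ∏ i ∈ d.support, x i ^ d i -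
          (algebraMap ℤ ℂ) (coeff d P) * ∏ i ∈ d.support, x' i ^ d i)‖
      ≤ ∑ d ∈ P.support, ‖(algebraMap ℤ ℂ) (coeff d P) * ∏ i ∈ d.support, x i ^ d i -
          (algebraMap ℤ ℂ) (coeff d P) * ∏ i ∈ d.support, x' i ^ d i‖ := norm_sum_le _ _
    _ ≤ ∑ d ∈ P.support, (normRingSeminorm ℤ) (coeff d P) * (P.totalDegree * A ^ P.totalDegree * ε) := by
        refine Finset.sum_le_sum fun d hd => ?_
        rw [← mul_sub, norm_mul]
        refine mul_le_mul ?_ ?_ (norm_nonneg _) (apply_nonneg _ _)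
        · simp
        · refine (norm_monomial_sub_le d x x' hA hε0 hx hx' hε).trans ?_
          have hdeg : degree d ≤ P.totalDegree := le_totalDegree hd
          have h1 : ((degree d : ℕ) : ℝ) ≤ P.totalDegree := by exact_mod_cast hdeg
          have h2 : A ^ degree d ≤ A ^ P.totalDegree := pow_le_pow_right₀ hA hdeg
          exact mul_le_mul (mul_le_mul h1 h2 (by positivity) (by positivity)) le_rfl hε0
            (by positivity)
    _ = l1 P * P.totalDegree * A ^ P.totalDegree * ε := by
        rw [l1, wnorm, Finset.sum_mul, Finset.sum_mul, Finset.sum_mul]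
        exact Finset.sum_congr rfl fun d _ => by ring

/-- `l1 P = 0 ↔ P = 0`. [folklore] -/
theorem l1_eq_zero_iff (P : MvPolynomial σ ℤ) : l1 P = 0 ↔ P = 0 := by
  constructor
  · intro h
    rw [l1, wnorm, Finset.sum_eq_zero_iff_of_nonneg (fun _ _ => apply_nonneg _ _)] at h
    ext m
    by_cases hm : m ∈ P.support
    · have := h m hm
      rw [normRingSeminorm_int_apply, abs_eq_zero] at this
      exact_mod_cast this
    · simpa using MvPolynomial.notMem_support_iff.mp hm
  · rintro rfl
    simp [l1]

/-- A non-zero integer polynomial has `ℓ¹`-norm `≥ 1`. [folklore] -/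
theorem one_le_l1 {P : MvPolynomial σ ℤ} (hP : P ≠ 0) : 1 ≤ l1 P := by
  obtain ⟨m, hm⟩ : ∃ m, m ∈ P.support := by
    by_contra h
    push Not at h
    exact hP (by ext m; simpa using MvPolynomial.notMem_support_iff.mp (h m))
  have hc : coeff m P ≠ 0 := MvPolynomial.mem_support_iff.mp hm
  calc (1 : ℝ) ≤ (normRingSeminorm ℤ) (coeff m P) := by
        rw [normRingSeminorm_int_apply]
        have : (1 : ℤ) ≤ |coeff m P| := Int.one_le_abs hc
        have : ((1 : ℤ) : ℝ) ≤ ((|coeff m P| : ℤ) : ℝ) := by exact_mod_cast this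
        simpa [Int.cast_abs] using this
    _ ≤ l1 P := le_wnorm _ P m

end Length

/-! ### `ℓ¹`-norms of Taylor coefficients -/

namespace Taylor

open Chudnovsky

variable {σ : Type*}

/-- The nested `ℓ¹`-norm on `ℤ[Y][Z]`: the sum of the `ℓ¹`-norms of the coefficients. [folklore] -/
abbrev totL1 (F : MvPolynomial σ (MvPolynomial σ ℤ)) : ℝ :=
  wnorm (l1Seminorm (normRingSeminorm ℤ)) F

/-- `L(coeff j F) ≤ totL1 F`. [folklore] -/
theorem l1_coeff_le_totL1 (F : MvPolynomial σ (MvPolynomial σ ℤ)) (j : σ →₀ ℕ) :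
    l1 (coeff j F) ≤ totL1 F :=
  le_wnorm (l1Seminorm (normRingSeminorm ℤ)) F j

/-- `l1Seminorm ℤ 1 = 1 ≤ 1` (needed for the product bounds). [folklore] -/
theorem l1Seminorm_int_one_le : (l1Seminorm (σ := σ) (normRingSeminorm ℤ)) 1 ≤ 1 := by
  rw [l1Seminorm_apply, wnorm_one, normRingSeminorm_int_one]

/-- `totL1 (Yᵢ + Zᵢ) ≤ 2`. [folklore] -/
theorem totL1_shift_X (i : σ) :
    totL1 (C (X i) + X i : MvPolynomial σ (MvPolynomial σ ℤ)) ≤ 2 := by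
  calc totL1 (C (X i) + X i : MvPolynomial σ (MvPolynomial σ ℤ))
      ≤ totL1 (C (X i) : MvPolynomial σ (MvPolynomial σ ℤ)) + totL1 (X i) := wnorm_add_le _ _ _
    _ = 2 := by
        rw [totL1, totL1, wnorm_C, wnorm_X, l1Seminorm_apply, l1Seminorm_apply, wnorm_X, wnorm_one,
          normRingSeminorm_int_one]
        norm_num

/-- `totL1 (P(Y+Z)) ≤ 2^{deg P} L(P)`. [folklore] -/
theorem totL1_shift_le [DecidableEq σ] (P : MvPolynomial σ ℤ) :
    totL1 (shift P) ≤ 2 ^ P.totalDegree * l1 P := by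
  have h1 := l1Seminorm_int_one_le (σ := σ)
  conv_lhs => rw [as_sum P]
  rw [map_sum]
  calc totL1 (∑ e ∈ P.support, shift (monomial e (coeff e P)))
      ≤ ∑ e ∈ P.support, totL1 (shift (monomial e (coeff e P))) := wnorm_sum_le _ _ _
    _ ≤ ∑ e ∈ P.support, 2 ^ P.totalDegree * (normRingSeminorm ℤ) (coeff e P) := by
        refine Finset.sum_le_sum fun e he => ?_
        have hmono : (shift (monomial e (coeff e P)) : MvPolynomial σ (MvPolynomial σ ℤ)) =
            C (C (coeff e P)) * ∏ i ∈ e.support, (C (X i) + X i) ^ e i := by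
          rw [shift, aeval_monomial, Finsupp.prod]
          rfl
        rw [hmono]
        have hc : totL1 (C (C (coeff e P)) : MvPolynomial σ (MvPolynomial σ ℤ)) =
            (normRingSeminorm ℤ) (coeff e P) := by
          rw [totL1, wnorm_C, l1Seminorm_apply, wnorm_C]
        have hprod : totL1 (∏ i ∈ e.support, (C (X i) + X i : MvPolynomial σ (MvPolynomial σ ℤ)) ^ e i)
            ≤ 2 ^ degree e := by
          refine (wnorm_prod_le _ h1 _ _).trans ?_
          calc ∏ i ∈ e.support, totL1 ((C (X i) + X i : MvPolynomial σ (MvPolynomial σ ℤ)) ^ e i)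
              ≤ ∏ i ∈ e.support, (2 : ℝ) ^ e i := by
                refine Finset.prod_le_prod (fun i _ => wnorm_nonneg _ _) fun i _ => ?_
                exact (wnorm_pow_le _ h1 _ _).trans
                  (pow_le_pow_left₀ (wnorm_nonneg _ _) (totL1_shift_X i) _)
            _ = 2 ^ degree e := by rw [Finset.prod_pow_eq_pow_sum, degree_apply]
        calc totL1 (C (C (coeff e P)) * ∏ i ∈ e.support, (C (X i) + X i) ^ e i)
            ≤ totL1 (C (C (coeff e P)) : MvPolynomial σ (MvPolynomial σ ℤ)) *
                totL1 (∏ i ∈ e.support, (C (X i) + X i : MvPolynomial σ (MvPolynomial σ ℤ)) ^ e i) :=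
              wnorm_mul_le _ _ _
          _ ≤ (normRingSeminorm ℤ) (coeff e P) * 2 ^ degree e := by
              rw [hc]
              exact mul_le_mul_of_nonneg_left hprod (apply_nonneg _ _)
          _ ≤ 2 ^ P.totalDegree * (normRingSeminorm ℤ) (coeff e P) := by
              rw [mul_comm]
              exact mul_le_mul_of_nonneg_right
                (pow_le_pow_right₀ (by norm_num) (le_totalDegree he)) (apply_nonneg _ _)
    _ = 2 ^ P.totalDegree * l1 P := by rw [l1, wnorm, Finset.mul_sum]

/-- **Heights of the derived polynomials**: `L(taylorCoeff j P) ≤ 2^{deg P} L(P)` (Diaz 1989, (3):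
`log H(P_{dλj}) ≤ c₂(D log M + LM)` from (1) and (2)). [cite: Diaz1989, §II-3-2 (3) p. 8] -/
theorem l1_taylorCoeff_le [DecidableEq σ] (j : σ →₀ ℕ) (P : MvPolynomial σ ℤ) :
    l1 (taylorCoeff j P) ≤ 2 ^ P.totalDegree * l1 P :=
  (l1_coeff_le_totL1 _ j).trans (totL1_shift_le P)

end Taylor

end Literature.NumberTheory.Transcendental

end
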